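import Mathlib
import Summits.NavierStokesRegularity.NavierStokesRegularity.Theorems.TypeIQuarterGateScarEnvelopeTypeISatelliteTowerGalleryBirkhoff

/-!
# A ROOT-RECURRENT exact minimiser exists in the gallery of every rooted A–B object

Rung (L11) `ExistsDoublyMinimal` of the crux idea `Cruxes/ScarEnvelopeTypeI/Ideas/zoom-recurrence.md`
(ns-idea-17 g0) on the crux `TypeIQuarterGate.ScarEnvelopeTypeI` (item 23843), in tree currency and
UNCONDITIONAL: for every ROOTED A–B object `(U, P, H)` of rate `M`, the PHASE SPACE of exact
minimisers — A–B gallery limits `W` of `U` with budget `≤ 4·𝐈(U)`, rooted, globally `m⋆`-rated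
(`m⋆` = the attained minimal scar rate of the gallery, module `…GalleryExactMin`) — is nonempty,
invariant under the root-zoom semiflow `T_λ` and sequentially closed/compact in `L³_loc`
(`ExactPhase.rootZoom`, `ExactPhase.exists_seqLimit`).  Equipped with the gallery distance it is a
nonempty compact pseudometric space on which `(0,1]` acts continuously (`eLpNorm_zoom_sub_zoom` makes
`T_λ` Lipschitz), so Birkhoff recurrence (`exists_recurrent_point`) yields an exact minimiser `W`
which is one of its own root ω-limits:

  `ABTower.exists_rootRecurrent_exactMinimiser`: `W` A–B of rate `M` AND of rate `m⋆`
  (`‖W(t,x)‖ ≤ m⋆/√(−t)` on the whole open past), gallery limit of `U`, `𝐈(W) ≤ 4·𝐈(U)`, rooted,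
  every scar of tight rate exactly `m⋆`, `m⋆` minimal over all scars of the gallery of `U`, and
  `IsRootOmegaLimit W W` (root-recurrent: `zoom W 0 0 l_j → W` in `L³_loc` along some `l_j → 0`).

This is the card's «single normalised enemy object» (doubly minimal: rate-minimal in the gallery and
recurrent under `T_λ`) WITHOUT the tame/non-tame dichotomy of (L7) and without pressure data.
HONEST FRAMING: compactness / dynamics tooling about hypothetical Type-I ancient objects; H3 wall
movement 0; nothing open is proved — 23843, `∀ M, ¬ OneScarLeaf M`, `∀ M, ¬ InfiniteDescent M`, the
class-wide (S∞), the route and Navier–Stokes regularity are OPEN.  LEAD-lineage prover ns-sz-p1 g6;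
`--supports stmt-NavierStokesRegularity-23843 --as helper`.
-/

noncomputable section

-- the summit-side namespace repeats a component by design (single-conjunct summit, D-0017)
set_option linter.dupNamespace false

open MeasureTheory Set Metric Filter Topology
open scoped ENNReal

namespace Summit.NavierStokesRegularity.NavierStokesRegularity.Cruxes.ScarEnvelopeTypeI.ZoomDictionary

section Recurrence

open Literature.Analysis.FluidPDE
variable {U W : ℝ → (EuclideanSpace ℝ (Fin 3)) → (EuclideanSpace ℝ (Fin 3))}
  {P : ℝ → (EuclideanSpace ℝ (Fin 3)) → ℝ}
  {H : ℝ → (EuclideanSpace ℝ (Fin 3)) → (EuclideanSpace ℝ (Fin 3)) →L[ℝ] (EuclideanSpace ℝ (Fin 3))}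
  {M m : ℝ}

/-! ### The phase space of exact minimisers -/

/-- **The phase space of exact minimisers** of the gallery of `(U, P, H)` at rate `m`: A–B gallery
limits `W` of `U` of rate `M` with budget `𝐈(W) ≤ 4·𝐈(U)`, ROOTED, globally `m`-rated. -/
def ExactPhase (M m : ℝ) (U : ℝ → (EuclideanSpace ℝ (Fin 3)) → (EuclideanSpace ℝ (Fin 3)))
    (P : ℝ → (EuclideanSpace ℝ (Fin 3)) → ℝ)
    (H : ℝ → (EuclideanSpace ℝ (Fin 3)) → (EuclideanSpace ℝ (Fin 3)) →L[ℝ] (EuclideanSpace ℝ (Fin 3)))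
    (W : ℝ → (EuclideanSpace ℝ (Fin 3)) → (EuclideanSpace ℝ (Fin 3))) : Prop :=
  (∃ (P' : ℝ → (EuclideanSpace ℝ (Fin 3)) → ℝ)
      (H' : ℝ → (EuclideanSpace ℝ (Fin 3)) → (EuclideanSpace ℝ (Fin 3)) →L[ℝ] (EuclideanSpace ℝ (Fin 3))),
      ABTower M W P' H' ∧
      typeIBound (Iio (0 : ℝ) ×ˢ univ) W P' H' ≤ 4 * typeIBound (Iio (0 : ℝ) ×ˢ univ) U P H) ∧
    HasTypeITimeDecay m W ∧ IsGalleryLimit U W ∧ ¬ RegPt W 0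

/-- Points of the phase space are `L³_loc` fields. -/
theorem ExactPhase.l3loc (h : ExactPhase M m U P H W) : L3loc W := by
  obtain ⟨⟨P', H', hAB, -⟩, -⟩ := h
  exact hAB.l3loc

/-- The root zoom at scale `l` is the KNSS rescaling `nsRescale l`. -/
theorem zoom_zero_eq_nsRescale (W : ℝ → (EuclideanSpace ℝ (Fin 3)) → (EuclideanSpace ℝ (Fin 3))) (l : ℝ) :
    zoom W 0 0 l = nsRescale l W := by
  funext s y
  simp only [zoom, nsRescale_apply, zero_add]

/-- **The phase space is invariant under the root-zoom semiflow** (every scale `l > 0`). -/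
theorem ExactPhase.rootZoom (h : ExactPhase M m U P H W) {l : ℝ} (hl : 0 < l) :
    ExactPhase M m U P H (zoom W 0 0 l) := by
  obtain ⟨⟨P', H', hAB, hI⟩, hdec, hg, h0⟩ := h
  refine ⟨⟨zoomP P' 0 0 l, l ^ 2 • stPull (l ^ 2) l 0 0 H', hAB.galleryMap 0 hl, ?_⟩, ?_,
    hg.galleryMap 0 hl, fun hr => h0 (regPt_of_regPt_zoom_zero hl hr)⟩
  · rw [typeIBound_galleryMap W P' H' 0 hl]
    exact hI
  · rw [zoom_zero_eq_nsRescale]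
    exact hdec.nsRescale hl

/-- From an a.e. rate on every `Q_R(0)` to the global Type-I time decay, for a field continuous on
the open past. -/
theorem hasTypeITimeDecay_of_ae_rate (hcont : ContinuousOn (Function.uncurry W) (Iio 0 ×ˢ univ))
    (h : ∀ R : ℝ, 0 < R → ∀ᵐ z ∂(volume.restrict (parabolicCylinder R (0 : ℝ × (EuclideanSpace ℝ (Fin 3))))),
      Real.sqrt (-z.1) * ‖W z.1 z.2‖ ≤ m) :
    HasTypeITimeDecay m W := by
  intro t ht x
  set R : ℝ := Real.sqrt (-t) + ‖x‖ + 1 with hRdef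
  have hR : 0 < R := by rw [hRdef]; positivity
  have hst : 0 < Real.sqrt (-t) := Real.sqrt_pos.2 (neg_pos.2 ht)
  have h1 := rate_everywhere_of_ae hcont (h R hR) t ⟨?_, ht⟩ x ?_
  · rwa [le_div_iff₀ hst, mul_comm]
  · have hsq : Real.sqrt (-t) ^ 2 = -t := Real.sq_sqrt (neg_pos.2 ht).le
    have : Real.sqrt (-t) < R := by rw [hRdef]; linarith [norm_nonneg x]
    nlinarith [Real.sqrt_nonneg (-t)]
  · rw [mem_ball_zero_iff, hRdef]
    linarith [Real.sqrt_nonneg (-t)]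

/-- **The phase space is sequentially compact in `L³_loc`** (up to re-representation): every
sequence in it has a subsequence converging in `L³(Q_R(0))`, every `R > 0`, to a member. -/
theorem ExactPhase.exists_seqLimit (hU : ABTower M U P H)
    {Ws : ℕ → ℝ → (EuclideanSpace ℝ (Fin 3)) → (EuclideanSpace ℝ (Fin 3))}
    (h : ∀ j, ExactPhase M m U P H (Ws j)) :
    ∃ (W' : ℝ → (EuclideanSpace ℝ (Fin 3)) → (EuclideanSpace ℝ (Fin 3))) (σ : ℕ → ℕ), StrictMono σ ∧
      ExactPhase M m U P H W' ∧
      ∀ R : ℝ, 0 < R → Tendsto (fun j => eLpNorm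
        (Function.uncurry (Ws (σ j)) - Function.uncurry W') 3
        (volume.restrict (parabolicCylinder R (0 : ℝ × (EuclideanSpace ℝ (Fin 3)))))) atTop (𝓝 0) := by
  choose Ps Hs hAB hI using fun j => (h j).1
  have hI4 : 4 * typeIBound (Iio (0 : ℝ) ×ˢ univ) U P H < ⊤ := ENNReal.mul_lt_top (by simp) hU.2.2.2
  obtain ⟨Wt, Pt, Ht, σ, hσ, hWtAB, -, hWt3, hconv, hpers⟩ := abTower_seqCompact hI4 Ws Ps Hs hAB hI
  have hWt0 : ¬ RegPt Wt 0 := hpers 0 (Frequently.of_forall fun j => (h (σ j)).2.2.2)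
  have hWtg : IsGalleryLimit U Wt :=
    IsGalleryLimit.of_tendsto (fun R hR => hU.aestronglyMeasurable_uncurry hR)
      (fun j => (h (σ j)).2.2.1) hWt3 hconv
  -- the global rate `m` passes to the limit a.e. on every `Q_R(0)`
  have hWtrate : ∀ R : ℝ, 0 < R →
      ∀ᵐ z ∂(volume.restrict (parabolicCylinder R (0 : ℝ × (EuclideanSpace ℝ (Fin 3))))),
        Real.sqrt (-z.1) * ‖Wt z.1 z.2‖ ≤ m := by
    intro R hR
    have hmeas : ∀ j, AEStronglyMeasurable (Function.uncurry (Ws (σ j)))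
        (volume.restrict (parabolicCylinder R (0 : ℝ × (EuclideanSpace ℝ (Fin 3))))) := fun j =>
      (hAB (σ j)).aestronglyMeasurable_uncurry hR
    obtain ⟨ψ, -, hae⟩ := exists_subseq_tendsto_ae₃ hmeas (hWt3 R hR).1 (hconv R hR)
    filter_upwards [hae, ae_restrict_mem (isOpen_parabolicCylinder R
      (0 : ℝ × (EuclideanSpace ℝ (Fin 3)))).measurableSet] with z hz hzmem
    have hz0 : z.1 < 0 := by
      have h1 := ((mem_parabolicCylinder).1 hzmem).1.2
      simpa using h1
    have hst : 0 < Real.sqrt (-z.1) := Real.sqrt_pos.2 (neg_pos.2 hz0)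
    refine le_of_tendsto (hz.norm.const_mul (Real.sqrt (-z.1))) (Eventually.of_forall fun i => ?_)
    have hd := (h (σ (ψ i))).2.1 z.1 hz0 z.2
    rw [le_div_iff₀ hst, mul_comm] at hd
    exact hd
  -- the A–B representative of budget `≤ 4 𝐈(U)`
  obtain ⟨W', P', H', hW'AB, hW'I, hae⟩ := abTower_of_isGalleryLimit hU hWtg
  refine ⟨W', σ, hσ, ⟨⟨P', H', hW'AB, hW'I⟩, ?_, hWtg.congr_ae hae, fun hr =>
    hWt0 (regPt_zero_of_ae_eq hr fun R hR => (hae R hR).mono fun z hz => hz.symm)⟩, fun R hR => ?_⟩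
  · refine hasTypeITimeDecay_of_ae_rate (towerObj_of_abTower hW'AB).2.1 fun R hR => ?_
    filter_upwards [hWtrate R hR, hae R hR] with z hz hzz
    rw [← hzz]
    exact hz
  · refine (hconv R hR).congr fun j => eLpNorm_congr_ae ?_
    refine (hae R hR).mono fun z hz => ?_
    have hz' : Function.uncurry Wt z = Function.uncurry W' z := hz
    simp only [Pi.sub_apply, hz']

/-- A point of the phase space of exact minimisers (a wrapper WITHOUT the product topology of the
function type, so that the gallery distance can furnish the topology). -/
structure PhasePt (M m : ℝ) (U : ℝ → (EuclideanSpace ℝ (Fin 3)) → (EuclideanSpace ℝ (Fin 3)))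
    (P : ℝ → (EuclideanSpace ℝ (Fin 3)) → ℝ)
    (H : ℝ → (EuclideanSpace ℝ (Fin 3)) → (EuclideanSpace ℝ (Fin 3)) →L[ℝ] (EuclideanSpace ℝ (Fin 3))) where
  /-- the field -/
  W : ℝ → (EuclideanSpace ℝ (Fin 3)) → (EuclideanSpace ℝ (Fin 3))
  /-- membership in the phase space -/
  mem : ExactPhase M m U P H W

/-- The phase space as a pseudometric space under the gallery distance (used locally via `letI`). -/
@[reducible] def PhasePt.pseudoMetricSpace (M m : ℝ) (U : ℝ → (EuclideanSpace ℝ (Fin 3)) → (EuclideanSpace ℝ (Fin 3)))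
    (P : ℝ → (EuclideanSpace ℝ (Fin 3)) → ℝ)
    (H : ℝ → (EuclideanSpace ℝ (Fin 3)) → (EuclideanSpace ℝ (Fin 3)) →L[ℝ] (EuclideanSpace ℝ (Fin 3))) :
    PseudoMetricSpace (PhasePt M m U P H) where
  dist a b := galleryDist a.W b.W
  dist_self a := galleryDist_self a.W
  dist_comm a b := galleryDist_comm a.W b.W
  dist_triangle a b c := galleryDist_triangle a.mem.l3loc b.mem.l3loc c.mem.l3loc

/-- `Q_r(0, 0) = Q_r(0)` (the two spellings of the root base point). -/
theorem parabolicCylinder_zero_pair (r : ℝ) :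
    parabolicCylinder r (((0 : ℝ), (0 : (EuclideanSpace ℝ (Fin 3)))) : ℝ × (EuclideanSpace ℝ (Fin 3))) =
      parabolicCylinder r (0 : ℝ × (EuclideanSpace ℝ (Fin 3))) := rfl

/-- **The root zooms are Lipschitz for the gallery distance** on `L³_loc` fields, `0 < l ≤ 1`. -/
theorem galleryDist_rootZoom_le {V W : ℝ → (EuclideanSpace ℝ (Fin 3)) → (EuclideanSpace ℝ (Fin 3))}
    (hV : L3loc V) (hW : L3loc W) {l : ℝ} (hl : 0 < l) (hl1 : l ≤ 1) :
    galleryDist (zoom V 0 0 l) (zoom W 0 0 l) ≤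
      max 1 (‖l‖ₑ * (ENNReal.ofReal (l ^ 2 * l ^ 3)⁻¹) ^ (1 / (3 : ℝ≥0∞).toReal)).toReal *
        galleryDist V W := by
  set C : ℝ := (‖l‖ₑ * (ENNReal.ofReal (l ^ 2 * l ^ 3)⁻¹) ^ (1 / (3 : ℝ≥0∞).toReal)).toReal with hCdef
  have hC : 0 ≤ C := ENNReal.toReal_nonneg
  have hK : 0 ≤ max 1 C := le_max_of_le_left zero_le_one
  refine galleryDist_le fun n => ?_
  have hn : (0 : ℝ) < (n : ℝ) + 1 := by positivity
  -- the cylinder distances scale: `cylDist n (T V) (T W) ≤ C · cylDist n V W`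
  have hcyl : cylDist n (zoom V 0 0 l) (zoom W 0 0 l) ≤ C * cylDist n V W := by
    rw [cylDist, cylDist, eLpNorm_zoom_sub_zoom V W 0 hl ((n : ℝ) + 1), hCdef, ← ENNReal.toReal_mul]
    refine ENNReal.toReal_mono (ENNReal.mul_ne_top (zoomConst_lt_top l).ne
      (((hV _ hn).sub (hW _ hn)).2.ne)) ?_
    refine mul_le_mul' le_rfl (eLpNorm_mono_measure _ (Measure.restrict_mono ?_ le_rfl))
    rw [parabolicCylinder_zero_pair]
    exact parabolicCylinder_mono (by positivity) (by nlinarith) _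
  have hp := cylDist_nonneg n V W
  have ht : (0 : ℝ) ≤ (1 / 2 : ℝ) ^ n := pow_nonneg (by norm_num) n
  -- `min (t, C p) ≤ max 1 C · min (t, p)`
  have key : min ((1 / 2 : ℝ) ^ n) (cylDist n (zoom V 0 0 l) (zoom W 0 0 l)) ≤
      max 1 C * min ((1 / 2 : ℝ) ^ n) (cylDist n V W) := by
    refine (min_le_min le_rfl hcyl).trans ?_
    rcases le_total ((1 / 2 : ℝ) ^ n) (cylDist n V W) with h | h
    · rw [min_eq_left h]
      calc min ((1 / 2 : ℝ) ^ n) (C * cylDist n V W) ≤ (1 / 2 : ℝ) ^ n := min_le_left _ _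
        _ = 1 * (1 / 2 : ℝ) ^ n := (one_mul _).symm
        _ ≤ max 1 C * (1 / 2 : ℝ) ^ n := by gcongr; exact le_max_left _ _
    · rw [min_eq_right h]
      calc min ((1 / 2 : ℝ) ^ n) (C * cylDist n V W) ≤ C * cylDist n V W := min_le_right _ _
        _ ≤ max 1 C * cylDist n V W := by gcongr; exact le_max_right _ _
  exact key.trans (mul_le_mul_of_nonneg_left (term_le_galleryDist n V W) hK)

/-! ### The root-recurrent exact minimiser -/

/-- **A ROOT-RECURRENT EXACT MINIMISER EXISTS IN THE GALLERY OF EVERY ROOTED A–B OBJECT**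
(rung (L11) of ns-idea-17's `zoom-recurrence`, unconditional, tree currency).  For a rooted A–B
object `(U, P, H)` of rate `M`: there are `m⋆ ≤ tightRate U 0` and an A–B gallery limit `W` of `U`
with budget `≤ 4·𝐈(U)`, ROOTED, of class `ABTower m⋆` (globally `m⋆`-rated), all of whose scars
have tight rate exactly `m⋆` — `m⋆` being minimal over all scars of all A–B gallery limits of `U` —
and which is ROOT-RECURRENT: `W` is one of its own root ω-limits (`IsRootOmegaLimit W W`). -/
theorem ABTower.exists_rootRecurrent_exactMinimiser (hU : ABTower M U P H) (h0 : ¬ RegPt U 0) :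
    ∃ (W : ℝ → (EuclideanSpace ℝ (Fin 3)) → (EuclideanSpace ℝ (Fin 3))) (P' : ℝ → (EuclideanSpace ℝ (Fin 3)) → ℝ)
      (H' : ℝ → (EuclideanSpace ℝ (Fin 3)) → (EuclideanSpace ℝ (Fin 3)) →L[ℝ] (EuclideanSpace ℝ (Fin 3)))
      (mstar : ℝ),
      ABTower M W P' H' ∧ ABTower mstar W P' H' ∧ IsGalleryLimit U W ∧
      typeIBound (Iio (0 : ℝ) ×ˢ univ) W P' H' ≤ 4 * typeIBound (Iio (0 : ℝ) ×ˢ univ) U P H ∧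
      ¬ RegPt W 0 ∧ mstar ≤ tightRate U 0 ∧
      (∀ y : (EuclideanSpace ℝ (Fin 3)), ¬ RegPt W y → tightRate W y = mstar) ∧
      (∀ (W₂ : ℝ → (EuclideanSpace ℝ (Fin 3)) → (EuclideanSpace ℝ (Fin 3))) (P₂ : ℝ → (EuclideanSpace ℝ (Fin 3)) → ℝ)
        (H₂ : ℝ → (EuclideanSpace ℝ (Fin 3)) → (EuclideanSpace ℝ (Fin 3)) →L[ℝ] (EuclideanSpace ℝ (Fin 3)))
        (y₂ : (EuclideanSpace ℝ (Fin 3))),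
        ABTower M W₂ P₂ H₂ → IsGalleryLimit U W₂ → ¬ RegPt W₂ y₂ → mstar ≤ tightRate W₂ y₂) ∧
      IsRootOmegaLimit W W := by
  classical
  -- ## the exact minimiser and the phase space at its rate `m⋆`
  obtain ⟨W₀, P₀, H₀, mstar, hW₀, hW₀m, hg₀, hI₀, hs₀, hmU, -, -, hmin⟩ :=
    hU.exists_galleryExactMinimiser h0
  have hphase₀ : ExactPhase M mstar U P H W₀ := ⟨⟨P₀, H₀, hW₀, hI₀⟩, hW₀m.1.2.2.2, hg₀, hs₀⟩
  -- ## the compact pseudometric phase space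
  letI : PseudoMetricSpace (PhasePt M mstar U P H) := PhasePt.pseudoMetricSpace M mstar U P H
  haveI : Nonempty (PhasePt M mstar U P H) := ⟨⟨W₀, hphase₀⟩⟩
  have hdist : ∀ a b : PhasePt M mstar U P H, dist a b = galleryDist a.W b.W := fun a b => rfl
  have hseq : IsSeqCompact (univ : Set (PhasePt M mstar U P H)) := by
    intro x _
    obtain ⟨W', σ, hσ, hW', hconv⟩ := ExactPhase.exists_seqLimit hU (fun j => (x j).mem)
    refine ⟨⟨W', hW'⟩, mem_univ _, σ, hσ, ?_⟩
    rw [tendsto_iff_dist_tendsto_zero]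
    simp only [Function.comp_apply, hdist]
    exact tendsto_galleryDist_of_tendsto hconv
  haveI : CompactSpace (PhasePt M mstar U P H) := ⟨isCompact_iff_isSeqCompact.2 hseq⟩
  -- ## the root-zoom semiflow on the phase space
  set T : ℝ → PhasePt M mstar U P H → PhasePt M mstar U P H :=
    fun l a => if hl : 0 < l then ⟨zoom a.W 0 0 l, a.mem.rootZoom hl⟩ else a with hTdef
  have hTpos : ∀ {l : ℝ} (hl : 0 < l) (a : PhasePt M mstar U P H),
      T l a = ⟨zoom a.W 0 0 l, a.mem.rootZoom hl⟩ := fun hl a => by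
    simp only [hTdef, dif_pos hl]
  have hcont : ∀ l : ℝ, 0 < l → l ≤ 1 → Continuous (T l) := by
    intro l hl hl1
    set K : ℝ := max 1 (‖l‖ₑ * (ENNReal.ofReal (l ^ 2 * l ^ 3)⁻¹) ^ (1 / (3 : ℝ≥0∞).toReal)).toReal
      with hKdef
    have hK : 0 ≤ K := le_max_of_le_left zero_le_one
    refine (LipschitzWith.of_dist_le_mul (K := K.toNNReal) fun a b => ?_).continuous
    rw [hTpos hl, hTpos hl, hdist, hdist, Real.coe_toNNReal _ hK]
    exact galleryDist_rootZoom_le a.mem.l3loc b.mem.l3loc hl hl1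
  have hmul : ∀ l μ : ℝ, 0 < l → l ≤ 1 → 0 < μ → μ ≤ 1 →
      ∀ a : PhasePt M mstar U P H, T l (T μ a) = T (l * μ) a := by
    intro l μ hl _ hμ _ a
    rw [hTpos hμ, hTpos hl, hTpos (mul_pos hl hμ)]
    congr 1
    rw [zoom_zoom_centre, smul_zero, add_zero, mul_comm]
  -- ## Birkhoff: a recurrent point
  obtain ⟨x, hx⟩ := exists_recurrent_point T hcont hmul
  have hkpos : ∀ k : ℕ, (0 : ℝ) < 1 / ((k : ℝ) + 1) := fun k => by positivity
  have hret : ∀ k : ℕ, ∃ l : ℝ, 0 < l ∧ l ≤ 1 / ((k : ℝ) + 1) ∧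
      galleryDist (zoom x.W 0 0 l) x.W < 1 / ((k : ℝ) + 1) := by
    intro k
    obtain ⟨y, ⟨l, hl, hlk, rfl⟩, hd⟩ := Metric.mem_closure_iff.1 (hx k) _ (hkpos k)
    refine ⟨l, hl, hlk, ?_⟩
    rwa [hdist, hTpos hl, galleryDist_comm] at hd
  choose l hl hlk hld using hret
  have hl0 : Tendsto l atTop (𝓝 0) :=
    squeeze_zero (fun k => (hl k).le) hlk tendsto_one_div_add_atTop_nhds_zero_nat
  have hdl : Tendsto (fun k => galleryDist (zoom x.W 0 0 (l k)) x.W) atTop (𝓝 0) :=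
    squeeze_zero (fun k => galleryDist_nonneg _ _) (fun k => (hld k).le)
      tendsto_one_div_add_atTop_nhds_zero_nat
  have hrec : IsRootOmegaLimit x.W x.W := by
    refine ⟨x.mem.l3loc, l, hl, hl0, fun R hR => ?_⟩
    exact tendsto_of_tendsto_galleryDist (fun k => (x.mem.rootZoom (hl k)).l3loc) x.mem.l3loc hdl hR
  -- ## read off the exact-minimiser data of the recurrent point
  obtain ⟨⟨P', H', hAB, hI⟩, hdec, hg, hs⟩ := x.mem
  have hABm : ABTower mstar x.W P' H' :=
    ⟨⟨hAB.1.1, hAB.1.2.1, hAB.1.2.2.1, hdec⟩, hAB.2.1, hAB.2.2.1, hAB.2.2.2⟩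
  have hscar : ∀ y : (EuclideanSpace ℝ (Fin 3)), ¬ RegPt x.W y → tightRate x.W y = mstar := fun y hy =>
    le_antisymm (tightRate_le_of_rateAt (rateAt_of_hasTypeITimeDecay hdec y))
      (hmin x.W P' H' y hAB hg hy)
  exact ⟨x.W, P', H', mstar, hAB, hABm, hg, hI, hs, hmU, hscar, hmin, hrec⟩

end Recurrence

end Summit.NavierStokesRegularity.NavierStokesRegularity.Cruxes.ScarEnvelopeTypeI.ZoomDictionary
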